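import Mathlib
import Summits.CriticalPhenomena.PercolationContinuityZ3.Theses.PercNearOneGluing

/-! Signatures (sorried — targets for the lead, NOT claims of Lean proofs) of the mixed exchange lemma MX and the
glue-free set-observer inequality (★★) at `A' = {a'}`, which together give `stub_gluingDefect` for `|A \ {a,b}| ≤ 1`
(paper proof in stubs/stub5-MX-note.md). Vocabulary as in Lines/sigma-recursion-lemma5-any-relay.lean. -/

namespace Summit.CriticalPhenomena.PercolationContinuityZ3.Cruxes.AdditiveGluing.DrefuteProbe

open MeasureTheory Set
open Literature.Probability.LatticeModels (prodBernoulli)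
open Literature.Probability.Percolation (BondConfig openConn)

noncomputable section
open Classical

variable {n : ℕ}

local notation "P[" w "]" => MeasureTheory.Measure.real (prodBernoulli w)

/-- same as the skeleton's `blockConn`. -/
def blockConn (O X : Finset (Fin n)) : Set (BondConfig (Fin n)) :=
  ⋃ o ∈ O, ⋃ x ∈ X, openConn o x

/-- **MX (mixed exchange).** `Q' = {S ↔ a'} ∩ {S ↮ a}` is increasing in `C(a')` and decreasing in `C(a)`;
if `a` is at most as reliable as `a'` then `P(Q', a↔b, a'↮b) ≤ P(Q', a'↔b, a↮b)`.
Paper proof: BHK 1.3 twice (X={a'}, X={a',b}) + spatial Markov at C(a) + Harris in the deleted graph. -/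
theorem mixedExchange (w : Sym2 (Fin n) → unitInterval) (S : Finset (Fin n)) (a a' b : Fin n)
    (ha : a ∉ S) (ha' : a' ∉ S)
    (h : P[w] (openConn a b) ≤ P[w] (openConn a' b)) :
    P[w] (openConn a b ∩ (openConn a' b)ᶜ ∩ (blockConn S {a'} ∩ (blockConn S {a})ᶜ)) ≤
      P[w] (openConn a' b ∩ (openConn a b)ᶜ ∩ (blockConn S {a'} ∩ (blockConn S {a})ᶜ)) := by
  sorry

/-- **(★★) at `A' = {a'}`** (glue-free form of `stub_gluingDefect` with `A = {a, a'}`; follows from `mixedExchange`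
by the set algebra of §3 of the note): `P(S↔a', S↮a, S↮b) ≤ P(a ↮ S ∪ {b}) + P(S↔b, S↮{a,a'})`. -/
theorem setObserver_designatedAG_two (w : Sym2 (Fin n) → unitInterval) (S : Finset (Fin n)) (a a' b : Fin n)
    (ha : a ∉ S) (ha' : a' ∉ S) (hb : b ∉ S)
    (h : P[w] (openConn a b) ≤ P[w] (openConn a' b)) :
    P[w] (blockConn S {a'} ∩ (blockConn S {a})ᶜ ∩ (blockConn S {b})ᶜ) ≤
      P[w] ((blockConn S {a})ᶜ ∩ (openConn a b)ᶜ) + P[w] (blockConn S {b} ∩ (blockConn S {a, a'})ᶜ) := by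
  sorry

end

end Summit.CriticalPhenomena.PercolationContinuityZ3.Cruxes.AdditiveGluing.DrefuteProbe
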